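import Summits.RiemannHypothesis.RiemannHypothesis.Theorems.PfPersistenceF3SharpLocalBound

/-!
# F3 — FE-honest twins `ζ·(1 + b p^{-s} + p^{1-2s})` — part 7: the PACKAGED window dichotomy — pub-rhpf fake-3

HONEST FRAMING: mechanism/rigidity campaign; no RH claims.

ADJ RULING A90 (b) (2026-08-19T13:28Z) accepted GAP G-F3-2 as KERNEL in both directions with the packaging remark:
"the dichotomy (`sharpLocalNegativeOrZetaNotPositive`, tree e53c9278be7b) concludes `Re Q_{F_{p,b}}(twin test) < 0`;
the corollary `¬ (sharpLocalDatum p b).PositivityOn (log p/2 + w)` additionally needs `IsWeilTest (sharpTwinTest p b g₁)`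
with support in the window — elementary but NOT packaged in tree; fake-3 may land it as a support".  This file is
that support: the F3-A test function is a Weil test supported in `[-(log p/2 + w), log p/2 + w]` (it is fake-5's
`twin (log p/2) (-sign b) g₁`, tree `PfPersistenceF5TailTwins`), hence the WINDOW DICHOTOMY

  `¬ ζ.PositivityOn (log p/2 + w) ∨ ¬ F_{p,b}.PositivityOn (log p/2 + w)`,

equivalently `ζ` and the non-tempered FE-honest twin `F_{p,b}` (`|b| > 2√p`) are never BOTH Weil-positive on a window
`(log p)/2 + w` on which `ζ` has a test of Rayleigh quotient below `((|b|/√p − 2) log p)/2` supported in `[-w, w]`.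
RH-free; standard axioms.  Weil's criterion for `F_{p,b}` itself stays CITED (Kaczorowski–Perelli 1999 Thm 2 /
Bombieri 2000), not tree.
-/

set_option linter.dupNamespace false

noncomputable section

open MeasureTheory Set Filter Complex
open scoped Real Topology

namespace Summit.RiemannHypothesis.RiemannHypothesis.Theorems.PfPersistenceBarrier

open Literature.NumberTheory.LFunctions ExplicitDatum

/-- The F3-A test function `sharpTwinTest p b g₁` is a Weil test whenever `g₁` is. [folklore] -/
theorem isWeilTest_sharpTwinTest (p : ℕ) (b : ℝ) {g₁ : ℝ → ℂ} (hg : IsWeilTest g₁) :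
    IsWeilTest (sharpTwinTest p b g₁) := by
  rw [F3A.sharpTwinTest_eq_twin]
  exact F3A.isWeilTest_twin hg _ _

/-- The F3-A test function built on `g₁` supported in `[-w, w]` is supported in the window
`[-(log p/2 + w), log p/2 + w]`. [folklore] -/
theorem tsupport_sharpTwinTest_subset (p : ℕ) (b : ℝ) {g₁ : ℝ → ℂ} {w : ℝ}
    (hs : tsupport g₁ ⊆ Icc (-w) w) :
    tsupport (sharpTwinTest p b g₁) ⊆ Icc (-(Real.log p / 2 + w)) (Real.log p / 2 + w) := by
  rw [F3A.sharpTwinTest_eq_twin]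
  have h0 : 0 ≤ Real.log p / 2 := by
    have := Real.log_natCast_nonneg p
    linarith
  exact F3A.tsupport_twin_subset hs h0 _

/-- PACKAGED WINDOW DICHOTOMY (ADJ RULING A90 (b); THEOREM F3-A corollary, RH-free): for a prime `p`,
`|b| > 2√p`, `0 < w`, `2w < log p` and a Weil test `g₁` supported in `[-w, w]` with `‖g₁‖₂² > 0` and
`Re Q_ζ(g₁) ≤ ε‖g₁‖₂²`, `2ε < (|b|/√p − 2) log p`: either `ζ` is NOT Weil-positive on the window
`(log p)/2 + w`, or the FE-honest twin `F_{p,b}` is NOT. [folklore] -/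
theorem zeta_not_positivityOn_or_sharpLocal_not_positivityOn {p : ℕ} (hp : p.Prime) {b w ε : ℝ}
    (hb : 2 * Real.sqrt p < |b|) (hw : 0 < w) (hw2 : 2 * w < Real.log p) {g₁ : ℝ → ℂ}
    (hg : IsWeilTest g₁) (hsupp : tsupport g₁ ⊆ Icc (-w) w)
    (hq : (weilQuadratic g₁).re ≤ ε * ∫ x, ‖g₁ x‖ ^ 2) (hpos : 0 < ∫ x, ‖g₁ x‖ ^ 2)
    (hε : 2 * ε < (|b| / Real.sqrt p - 2) * Real.log p) :
    ¬ zetaDatum.PositivityOn (Real.log p / 2 + w) ∨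
      ¬ (sharpLocalDatum p b).PositivityOn (Real.log p / 2 + w) := by
  rcases sharpLocalNegativeOrZetaNotPositive p hp b w ε hb hw hw2 g₁ hg hsupp hq hpos hε with h | h
  · exact Or.inl h
  · refine Or.inr fun hF ↦ ?_
    have h0 := hF (sharpTwinTest p b g₁) (isWeilTest_sharpTwinTest p b hg)
      (tsupport_sharpTwinTest_subset p b hsupp)
    linarith

/-- The same, read as "never both": under the hypotheses of the dichotomy, `ζ` and `F_{p,b}` are not
simultaneously Weil-positive on the window `(log p)/2 + w`. [folklore] -/
theorem not_positivityOn_zeta_and_sharpLocal {p : ℕ} (hp : p.Prime) {b w ε : ℝ}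
    (hb : 2 * Real.sqrt p < |b|) (hw : 0 < w) (hw2 : 2 * w < Real.log p) {g₁ : ℝ → ℂ}
    (hg : IsWeilTest g₁) (hsupp : tsupport g₁ ⊆ Icc (-w) w)
    (hq : (weilQuadratic g₁).re ≤ ε * ∫ x, ‖g₁ x‖ ^ 2) (hpos : 0 < ∫ x, ‖g₁ x‖ ^ 2)
    (hε : 2 * ε < (|b| / Real.sqrt p - 2) * Real.log p) :
    ¬ (zetaDatum.PositivityOn (Real.log p / 2 + w) ∧
        (sharpLocalDatum p b).PositivityOn (Real.log p / 2 + w)) := by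
  rcases zeta_not_positivityOn_or_sharpLocal_not_positivityOn hp hb hw hw2 hg hsupp hq hpos hε with h | h
  · exact fun hh ↦ h hh.1
  · exact fun hh ↦ h hh.2

end Summit.RiemannHypothesis.RiemannHypothesis.Theorems.PfPersistenceBarrier
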